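import Mathlib
import Literature.Combinatorics.Expanders.BoundedConcentrator

/-!
# `SnSubsetDichotomy.PolynomialSlack`, line `transport-split-hull` — avoidance cost

Two counting estimates for the level-one template calculus of crux
`stmt-MatrixMultiplication-8306` (line `transport-split-hull`).  A pair quotient set `A = S⁻¹T`
with an EMPTY DEFICIT BLOCK — every `a ∈ A` maps the position block `X` outside the value block
`Z` — lies inside `{g ∈ S_n : g(X) ∩ Z = ∅}`, whose density is
`C(n - |Z|, |X|) / C(n, |X|) ≤ (1 - |Z|/n)^{|X|} ≤ e^{-|X||Z|/n}`:

* `card_perm_mapsTo_mul_pow_le`: `#{g ∈ S_n : g(X) ⊆ W} · n^{|X|} ≤ n! · |W|^{|X|}`;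
* `card_perm_mapsTo_le`: `#{g ∈ S_n : g(X) ⊆ W} ≤ n! · (|W|/n)^{|X|}`;
* `card_perm_image_disjoint_le`: `#{g ∈ S_n : g(X) ∩ Z = ∅} ≤ n! · exp(-|X||Z|/n)`.

The exact count `#{g : g(X) ⊆ W} · C(n,|X|) = C(|W|,|X|) · n!` and the ratio estimate
`C(w,x) · n^x ≤ C(n,x) · w^x` (`w ≤ n`) are
`Literature.Combinatorics.Expanders.card_perm_mapsTo_mul_choose` and
`Literature.Combinatorics.Expanders.choose_mul_pow_le_choose_mul_pow`; here we only clear the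
denominator `C(n,|X|)` and pass to the exponential through `1 + t ≤ exp t`.
-/

namespace Summit.MatrixMultiplication.MatrixMultiplication.Theorems.PolynomialSlack

open scoped BigOperators

set_option linter.dupNamespace false

/-- `#{g ∈ S_n : g(X) ⊆ W} · n^{|X|} ≤ n! · |W|^{|X|}`: the natural-number form of the
avoidance cost, from `#{g : g(X) ⊆ W} · C(n,|X|) = C(|W|,|X|) · n!` and
`C(|W|,|X|) · n^{|X|} ≤ C(n,|X|) · |W|^{|X|}`. [folklore] -/
theorem card_perm_mapsTo_mul_pow_le {n : ℕ} (X W : Finset (Fin n)) :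
    (Finset.univ.filter fun g : Equiv.Perm (Fin n) => ∀ x ∈ X, g x ∈ W).card * n ^ X.card ≤
      n.factorial * W.card ^ X.card := by
  -- the exact count `#{g : g(X) ⊆ W} · C(n,|X|) = C(|W|,|X|) · n!` (BCS Lemma 13.32's count, as
  -- formalised in `Literature.Combinatorics.Expanders`); `convert` aligns the decidability
  -- instances of the two elaborations of the filter predicate
  have hcount : (Finset.univ.filter fun g : Equiv.Perm (Fin n) => ∀ x ∈ X, g x ∈ W).card *
      n.choose X.card = W.card.choose X.card * n.factorial := by
    have h := Literature.Combinatorics.Expanders.card_perm_mapsTo_mul_choose X W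
    rw [Fintype.card_fin] at h
    convert h using 4
  have hXn : X.card ≤ n := X.card_le_univ.trans_eq (Fintype.card_fin n)
  have hWn : W.card ≤ n := W.card_le_univ.trans_eq (Fintype.card_fin n)
  have hchoose :=
    Literature.Combinatorics.Expanders.choose_mul_pow_le_choose_mul_pow hWn X.card
  refine Nat.le_of_mul_le_mul_right ?_ (Nat.choose_pos hXn)
  calc (Finset.univ.filter fun g : Equiv.Perm (Fin n) => ∀ x ∈ X, g x ∈ W).card * n ^ X.card *
        n.choose X.card
      = (Finset.univ.filter fun g : Equiv.Perm (Fin n) => ∀ x ∈ X, g x ∈ W).card *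
          n.choose X.card * n ^ X.card := by ring
    _ = W.card.choose X.card * n.factorial * n ^ X.card := by rw [hcount]
    _ = W.card.choose X.card * n ^ X.card * n.factorial := by ring
    _ ≤ n.choose X.card * W.card ^ X.card * n.factorial := Nat.mul_le_mul_right _ hchoose
    _ = n.factorial * W.card ^ X.card * n.choose X.card := by ring

/-- **Avoidance cost.** The permutations of `Fin n` mapping `X` into `W` number at most
`n! · (|W|/n)^{|X|}`: the image of `X` under a uniformly random permutation is a uniformly
random `|X|`-subset, so
`P(g(X) ⊆ W) = C(|W|,|X|)/C(n,|X|) = ∏_{i<|X|} (|W|-i)/(n-i) ≤ (|W|/n)^{|X|}`. [folklore] -/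
theorem card_perm_mapsTo_le {n : ℕ} (X W : Finset (Fin n)) :
    (((Finset.univ.filter fun g : Equiv.Perm (Fin n) => ∀ x ∈ X, g x ∈ W).card : ℕ) : ℝ) ≤
      n.factorial * ((W.card : ℝ) / n) ^ X.card := by
  have h := card_perm_mapsTo_mul_pow_le X W
  have h' :
      (((Finset.univ.filter fun g : Equiv.Perm (Fin n) => ∀ x ∈ X, g x ∈ W).card : ℕ) : ℝ) *
        (n : ℝ) ^ X.card ≤ n.factorial * (W.card : ℝ) ^ X.card := by
    exact_mod_cast h
  rcases Nat.eq_zero_or_pos n with hn | hn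
  · have hXn : X.card ≤ n := X.card_le_univ.trans_eq (Fintype.card_fin n)
    have hX : X.card = 0 := by omega
    rw [hX, pow_zero, pow_zero, mul_one, mul_one] at h'
    rw [hX, pow_zero, mul_one]
    exact h'
  · have hn' : (0 : ℝ) < (n : ℝ) ^ X.card := by positivity
    rw [div_pow, ← mul_div_assoc, le_div_iff₀ hn']
    exact h'

/-- **Avoidance cost, exponential form.** The permutations of `Fin n` mapping `X` outside `Z`
number at most `n! · exp(-|X||Z|/n)`: apply `card_perm_mapsTo_le` with `W = Zᶜ`,
`|W| = n - |Z|`, and `(1 - |Z|/n)^{|X|} ≤ exp(-|Z|/n)^{|X|} = exp(-|X||Z|/n)`. [folklore] -/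
theorem card_perm_image_disjoint_le {n : ℕ} (X Z : Finset (Fin n)) :
    (((Finset.univ.filter fun g : Equiv.Perm (Fin n) => ∀ x ∈ X, g x ∉ Z).card : ℕ) : ℝ) ≤
      n.factorial * Real.exp (-((X.card * Z.card : ℕ) : ℝ) / n) := by
  have hfilter : (Finset.univ.filter fun g : Equiv.Perm (Fin n) => ∀ x ∈ X, g x ∉ Z) =
      Finset.univ.filter fun g : Equiv.Perm (Fin n) => ∀ x ∈ X, g x ∈ Zᶜ :=
    Finset.filter_congr fun g _ => by simp only [Finset.mem_compl]
  rw [hfilter]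
  refine (card_perm_mapsTo_le X Zᶜ).trans ?_
  refine mul_le_mul_of_nonneg_left ?_ (Nat.cast_nonneg _)
  have hXn : X.card ≤ n := X.card_le_univ.trans_eq (Fintype.card_fin n)
  have hZn : Z.card ≤ n := Z.card_le_univ.trans_eq (Fintype.card_fin n)
  have hZc : (Zᶜ.card : ℝ) = (n : ℝ) - Z.card := by
    rw [Finset.card_compl, Fintype.card_fin, Nat.cast_sub hZn]
  rcases Nat.eq_zero_or_pos n with hn | hn
  · have hX : X.card = 0 := by omega
    subst hn
    rw [hX, pow_zero, zero_mul, Nat.cast_zero, neg_zero, zero_div, Real.exp_zero]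
  · have hn' : (0 : ℝ) < n := Nat.cast_pos.mpr hn
    have hn0 : (n : ℝ) ≠ 0 := hn'.ne'
    have hz : (Z.card : ℝ) ≤ n := by exact_mod_cast hZn
    rw [hZc]
    calc (((n : ℝ) - Z.card) / n) ^ X.card ≤ (Real.exp (-(Z.card : ℝ) / n)) ^ X.card := by
          apply pow_le_pow_left₀ (div_nonneg (sub_nonneg.mpr hz) hn'.le)
          have h1 := Real.add_one_le_exp (-(Z.card : ℝ) / n)
          calc ((n : ℝ) - Z.card) / n = -(Z.card : ℝ) / n + 1 := by
                rw [sub_div, div_self hn0]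
                ring
            _ ≤ Real.exp (-(Z.card : ℝ) / n) := h1
      _ = Real.exp (-((X.card * Z.card : ℕ) : ℝ) / n) := by
          rw [← Real.exp_nat_mul]
          congr 1
          push_cast
          ring

end Summit.MatrixMultiplication.MatrixMultiplication.Theorems.PolynomialSlack
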